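import Summits.QuantumFields.YangMills.Theorems.BalabanLadderUVSeamRecPenetrationDefs
import Literature.MathematicalPhysics.QuantumLattice.LatticeGaugeDLRBoxFreezing
import Summits.QuantumFields.YangMills.Theorems.LangevinControlUVOSLegsFromFemtoAndGapStubCollar6
import Literature.MathematicalPhysics.StatisticalMechanics.ZeroTemperatureConcentration
import HarnessLib

/-!
# Crux `UVSeamRec` (stmt-QuantumFields-20043) / `NT` (stmt-QuantumFields-19353): the `β → ∞` (Laplace) step for the cube
# kernels `kerE`, and the reduction of `PlanePenetrationAtRate` / `DensPenetrationAtRate` to CLASSICAL ground-state statements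

Refuter∕disprover seat `ym-cdisprove-19353-penetration` (R282 WIDTH-LEVER cdisprove; `--supports stmt-QuantumFields-20043`, helper).
`BalabanLadderUVSeamRecPenetrationDefs` (p518535/p520592) proves `PlanePenetrationAtRate ρ → ¬FBL6` and
`DensPenetrationAtRate ρ → ¬FBL ∧ ¬E1-osc` for every rate with `ρ(n)·n⁴ → ∞` (e.g. `ρ = 1/n²`).  Those hypotheses speak about the
kernel means `kerE β` at ALL large `β`; the seat's numerical attack (classical minimisation of the Wilson action in `b⁴` boxes with
frozen coherent exteriors, kit `cool2`) speaks about `β = ∞`.  This file closes that gap once and for all, kernel-checked: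

* `kerE_eventually_ge` / `kerE_eventually_le` — **zero-temperature one-sided bounds for the cube kernel**: if a continuous observable
  `F` is `≥ t` (resp. `≤ t`) on every GROUND STATE of the cube `(c, b)` with exterior `η` (minimisers over the compact fibre
  `G^{cubeEdges c b}` of the boundary Wilson action of the glued configuration, `cubeMinimisers`), then for every `ε > 0`,
  `kerE β c b η F ≥ t − ε` (resp. `≤ t + ε`) for all large `β` — Hwang's Theorem 2.1 in its degenerate (non-unique-minimiser)
  form (`Literature.…StatisticalMechanics.gibbsAverage_eventually_ge/le`, p517756's file) transported through the integral formula
  `Literature.…QuantumLattice.integral_ymSpecification`; no uniqueness of the minimiser is needed (the minimum set of a box with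
  frozen walls is a union of residual-gauge orbits and may be a continuum);
* `ClassicalPlanePenetrationAtRate ρ` / `ClassicalDensPenetrationAtRate ρ` — the purely VARIATIONAL statements: an orientation `q`,
  a floor `θ > 0`, and for every target depth a cube, a site `x` of that depth and two exteriors `η, η'` whose ground-state values of
  `plane q x` (resp. `dens x`) are separated — `≤ t` for `η`, `≥ t'` for `η'`, with `t' − t > θ·ρ(depth)`;
* `planePenetrationAtRate_of_classical`, `densPenetrationAtRate_of_classical` — classical ⇒ kernel version (`ε = ` half the slack);
* `not_fbl6_of_classicalPlanePenetrationAtRate`, `not_fbl_of_classicalDensPenetrationAtRate`,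
  `not_e1osc_of_classicalDensPenetrationAtRate` and the `ρ = 1/n²` specialisations — the end-to-end conditional refutations:
  a classical interior-flux PLATEAU `B_int(b)·b ≥ κ > 0` under a coherent exterior (centre plaquette angle `≥ κ/b`, i.e.
  `1 − ½tr ≥ κ²/(2b²) = (κ²/8)/depth²` against `0` for the identity exterior) is `ClassicalPlanePenetrationAtRate (1/n²)` and sinks
  `FBL6`, `FBL` and E1-osc for every unit map `a → 0`.

Continuity of `plane`/`dens` is reused from the landed `StubCollar6`/`StubCollar` files.  Nothing here asserts the classical hypothesis (the seat's kit data decide between PLATEAU and FUNNEL — see the seat's FINDING);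
nothing here is a claim about NT, E0′ or the mass gap.  No sorry; standard axioms.
-/

set_option autoImplicit false

noncomputable section

open MeasureTheory Filter Topology
open Literature.MathematicalPhysics.QuantumFieldTheory Literature.MathematicalPhysics.QuantumLattice
open Literature.MathematicalPhysics.StatisticalMechanics
open Literature.Probability.LatticeModels
open Summit.QuantumFields.YangMills.Cruxes.OSLegsFromFemtoAndGap.DlrCollarTransfer

namespace Summit.QuantumFields.YangMills.Cruxes.UVSeamRec.BoundaryLawPenetration

variable (G : Type) [Group G] [TopologicalSpace G] [IsTopologicalGroup G] [CompactSpace G]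
  [MeasurableSpace G] [BorelSpace G] (r : LatticeRep G)

/-- **Ground states of the cube kernel.**  The inner configurations `ζ ∈ G^{cubeEdges c b}` minimising the boundary Wilson action
of the cube glued into the exterior `η` (the `β = ∞` support of `kerE · c b η`). -/
def cubeMinimisers (c : Fin 4 → ℤ) (b : ℕ) (η : LGConfig 4 G) : Set (↥(cubeEdges c b) → G) :=
  {ζ | ∀ ζ' : ↥(cubeEdges c b) → G,
    wilsonBoundaryAction r.ρ (cubeEdges c b) (glueWith (cubeEdges c b) ζ η) ≤
      wilsonBoundaryAction r.ρ (cubeEdges c b) (glueWith (cubeEdges c b) ζ' η)}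

/-- **Classical plane penetration at rate `ρ`.**  An orientation `q = (i < j)`, a floor `θ > 0`, and for every target depth
`d₀ ≥ 1` a cube `(c, b)`, a site `x` of depth `≥ max d₀ 2`, two exteriors `η, η'` and levels `t < t'` with `θ·ρ(depth) < t' − t`
such that the single-plane plaquette field `plane q x` is `≤ t` on every ground state of the cube with exterior `η` and `≥ t'` on
every ground state with exterior `η'`.  (The seat's candidate: `η` = coherent single-plane / self-dual abelian flux, `η'` = the
identity exterior, `x` = the centre, `t' = r.N`, `t = r.N − (plateau response)`.) -/
def ClassicalPlanePenetrationAtRate (ρ : ℕ → ℝ) : Prop :=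
  ∃ (q : Fin 4 × Fin 4) (θ : ℝ), q.1 < q.2 ∧ 0 < θ ∧ ∀ d₀ : ℕ, 1 ≤ d₀ →
    ∃ (c : Fin 4 → ℤ) (b : ℕ) (x : Fin 4 → ℤ) (η η' : LGConfig 4 G) (t t' : ℝ),
      d₀ ≤ depth c b x ∧ 2 ≤ depth c b x ∧ θ * ρ (depth c b x) < t' - t ∧
      (∀ ζ ∈ cubeMinimisers G r c b η, plane G r q x (glueWith (cubeEdges c b) ζ η) ≤ t) ∧
      (∀ ζ ∈ cubeMinimisers G r c b η', t' ≤ plane G r q x (glueWith (cubeEdges c b) ζ η'))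

/-- **Classical density penetration at rate `ρ`** — the same for the action density `dens x`. -/
def ClassicalDensPenetrationAtRate (ρ : ℕ → ℝ) : Prop :=
  ∃ θ : ℝ, 0 < θ ∧ ∀ d₀ : ℕ, 1 ≤ d₀ →
    ∃ (c : Fin 4 → ℤ) (b : ℕ) (x : Fin 4 → ℤ) (η η' : LGConfig 4 G) (t t' : ℝ),
      d₀ ≤ depth c b x ∧ 2 ≤ depth c b x ∧ θ * ρ (depth c b x) < t' - t ∧
      (∀ ζ ∈ cubeMinimisers G r c b η, dens G r x (glueWith (cubeEdges c b) ζ η) ≤ t) ∧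
      (∀ ζ ∈ cubeMinimisers G r c b η', t' ≤ dens G r x (glueWith (cubeEdges c b) ζ η'))

variable {G r}

/-! ### The zero-temperature step for `kerE` -/

omit [MeasurableSpace G] [BorelSpace G] in
/-- The cube has a ground state (compactness of `G^{cubeEdges c b}`). [folklore] -/
theorem cubeMinimisers_nonempty (c : Fin 4 → ℤ) (b : ℕ) (η : LGConfig 4 G) : (cubeMinimisers G r c b η).Nonempty := by
  have hglue : Continuous fun ζ : ↥(cubeEdges c b) → G => glueWith (cubeEdges c b) ζ η :=
    (continuous_glueWith_prod (cubeEdges c b)).comp (Continuous.prodMk_right η)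
  have hSc : Continuous fun ζ : ↥(cubeEdges c b) → G =>
      wilsonBoundaryAction r.ρ (cubeEdges c b) (glueWith (cubeEdges c b) ζ η) :=
    (continuous_wilsonBoundaryAction r.ρ r.continuous (cubeEdges c b)).comp hglue
  obtain ⟨ζ₀, -, hζ₀⟩ := isCompact_univ.exists_isMinOn Set.univ_nonempty hSc.continuousOn
  exact ⟨ζ₀, fun ζ' => hζ₀ (Set.mem_univ ζ')⟩

section Laplace

variable [SecondCountableTopology G]

/-- **Zero-temperature lower bound for the cube kernel** (Hwang's Thm 2.1, degenerate form, transported to `kerE`): if a continuous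
`F` is `≥ t` on every ground state of the cube `(c, b)` with exterior `η`, then `kerE β c b η F ≥ t − ε` for all large `β`.
[cite: Hwang1980, Thm 2.1] -/
theorem kerE_eventually_ge (c : Fin 4 → ℤ) (b : ℕ) (η : LGConfig 4 G) {F : LGConfig 4 G → ℝ} (hF : Continuous F)
    {t : ℝ} (ht : ∀ ζ ∈ cubeMinimisers G r c b η, t ≤ F (glueWith (cubeEdges c b) ζ η)) {ε : ℝ} (hε : 0 < ε) :
    ∀ᶠ β : ℝ in atTop, t - ε ≤ kerE G r β c b η F := by
  haveI : (haarProbability G).IsOpenPosMeasure := by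
    unfold haarProbability; infer_instance
  haveI : IsFiniteMeasure (haarProbability G) := by
    unfold haarProbability; infer_instance
  set Λ := cubeEdges c b with hΛ
  set μ : Measure (↥Λ → G) := Measure.pi fun _ : ↥Λ => haarProbability G with hμ
  have hglue : Continuous fun ζ : ↥Λ → G => glueWith Λ ζ η :=
    (continuous_glueWith_prod Λ).comp (Continuous.prodMk_right η)
  have hSc : Continuous fun ζ : ↥Λ → G => wilsonBoundaryAction r.ρ Λ (glueWith Λ ζ η) :=
    (continuous_wilsonBoundaryAction r.ρ r.continuous Λ).comp hglue
  have hgc : Continuous fun ζ : ↥Λ → G => F (glueWith Λ ζ η) := hF.comp hglue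
  obtain ⟨ζ₀, hζ₀⟩ := cubeMinimisers_nonempty (G := G) (r := r) c b η
  have hmin : ∀ ζ' : ↥Λ → G, wilsonBoundaryAction r.ρ Λ (glueWith Λ ζ₀ η) ≤
      wilsonBoundaryAction r.ρ Λ (glueWith Λ ζ' η) := hζ₀
  have hsupp : ∀ V : Set (↥Λ → G), IsOpen V → ζ₀ ∈ V → 0 < μ.real V := fun V hV hζV =>
    ENNReal.toReal_pos (hV.measure_pos μ ⟨ζ₀, hζV⟩).ne' (measure_ne_top μ V)
  have hc : ∀ ζ : ↥Λ → G, wilsonBoundaryAction r.ρ Λ (glueWith Λ ζ η) = wilsonBoundaryAction r.ρ Λ (glueWith Λ ζ₀ η) →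
      t ≤ F (glueWith Λ ζ η) := fun ζ hζ => ht ζ fun ζ' => by rw [hζ]; exact hmin ζ'
  have h := gibbsAverage_eventually_ge μ hSc hgc hmin hsupp hc hε
  refine h.mono fun β hβ => ?_
  unfold kerE
  rw [integral_ymSpecification r.ρ r.continuous β Λ hF.measurable η]
  exact hβ

/-- **Zero-temperature upper bound for the cube kernel**: if a continuous `F` is `≤ t` on every ground state of the cube with
exterior `η`, then `kerE β c b η F ≤ t + ε` for all large `β`. [cite: Hwang1980, Thm 2.1] -/
theorem kerE_eventually_le (c : Fin 4 → ℤ) (b : ℕ) (η : LGConfig 4 G) {F : LGConfig 4 G → ℝ} (hF : Continuous F)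
    {t : ℝ} (ht : ∀ ζ ∈ cubeMinimisers G r c b η, F (glueWith (cubeEdges c b) ζ η) ≤ t) {ε : ℝ} (hε : 0 < ε) :
    ∀ᶠ β : ℝ in atTop, kerE G r β c b η F ≤ t + ε := by
  haveI : (haarProbability G).IsOpenPosMeasure := by
    unfold haarProbability; infer_instance
  haveI : IsFiniteMeasure (haarProbability G) := by
    unfold haarProbability; infer_instance
  set Λ := cubeEdges c b with hΛ
  set μ : Measure (↥Λ → G) := Measure.pi fun _ : ↥Λ => haarProbability G with hμ
  have hglue : Continuous fun ζ : ↥Λ → G => glueWith Λ ζ η :=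
    (continuous_glueWith_prod Λ).comp (Continuous.prodMk_right η)
  have hSc : Continuous fun ζ : ↥Λ → G => wilsonBoundaryAction r.ρ Λ (glueWith Λ ζ η) :=
    (continuous_wilsonBoundaryAction r.ρ r.continuous Λ).comp hglue
  have hgc : Continuous fun ζ : ↥Λ → G => F (glueWith Λ ζ η) := hF.comp hglue
  obtain ⟨ζ₀, hζ₀⟩ := cubeMinimisers_nonempty (G := G) (r := r) c b η
  have hmin : ∀ ζ' : ↥Λ → G, wilsonBoundaryAction r.ρ Λ (glueWith Λ ζ₀ η) ≤
      wilsonBoundaryAction r.ρ Λ (glueWith Λ ζ' η) := hζ₀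
  have hsupp : ∀ V : Set (↥Λ → G), IsOpen V → ζ₀ ∈ V → 0 < μ.real V := fun V hV hζV =>
    ENNReal.toReal_pos (hV.measure_pos μ ⟨ζ₀, hζV⟩).ne' (measure_ne_top μ V)
  have hc : ∀ ζ : ↥Λ → G, wilsonBoundaryAction r.ρ Λ (glueWith Λ ζ η) = wilsonBoundaryAction r.ρ Λ (glueWith Λ ζ₀ η) →
      F (glueWith Λ ζ η) ≤ t := fun ζ hζ => ht ζ fun ζ' => by rw [hζ]; exact hmin ζ'
  have h := gibbsAverage_eventually_le μ hSc hgc hmin hsupp hc hε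
  refine h.mono fun β hβ => ?_
  unfold kerE
  rw [integral_ymSpecification r.ρ r.continuous β Λ hF.measurable η]
  exact hβ

/-- From one-sided ground-state bounds for two exteriors to a `β`-uniform response floor: if `F ≤ t` on the ground states of
`η`, `F ≥ t'` on those of `η'`, and `gap < t' − t`, then `gap ≤ |kerE β η F − kerE β η' F|` for all `β ≥ β₀`. [folklore] -/
theorem exists_beta_response_of_classical (c : Fin 4 → ℤ) (b : ℕ) (η η' : LGConfig 4 G) {F : LGConfig 4 G → ℝ}
    (hF : Continuous F) {t t' gap : ℝ} (hgap : gap < t' - t)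
    (hle : ∀ ζ ∈ cubeMinimisers G r c b η, F (glueWith (cubeEdges c b) ζ η) ≤ t)
    (hge : ∀ ζ ∈ cubeMinimisers G r c b η', t' ≤ F (glueWith (cubeEdges c b) ζ η')) :
    ∃ β₀ : ℝ, ∀ β : ℝ, β₀ ≤ β → gap ≤ |kerE G r β c b η F - kerE G r β c b η' F| := by
  have hε : 0 < (t' - t - gap) / 2 := by linarith
  have h1 := kerE_eventually_le (G := G) (r := r) c b η hF hle hε
  have h2 := kerE_eventually_ge (G := G) (r := r) c b η' hF hge hε
  obtain ⟨β₀, hβ₀⟩ := Filter.eventually_atTop.1 (h1.and h2)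
  refine ⟨β₀, fun β hβ => ?_⟩
  obtain ⟨ha, hb⟩ := hβ₀ β hβ
  have hdiff : gap ≤ kerE G r β c b η' F - kerE G r β c b η F := by linarith
  rw [abs_sub_comm]
  exact hdiff.trans (le_abs_self _)

/-- **Classical ⇒ kernel, plane version.** [folklore] -/
theorem planePenetrationAtRate_of_classical {ρ : ℕ → ℝ} (h : ClassicalPlanePenetrationAtRate G r ρ) :
    PlanePenetrationAtRate G r ρ := by
  obtain ⟨q, θ, hq, hθ, hfam⟩ := h
  refine ⟨q, θ, hq, hθ, fun d₀ hd₀ => ?_⟩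
  obtain ⟨c, b, x, η, η', t, t', hd, h2, hgap, hle, hge⟩ := hfam d₀ hd₀
  exact ⟨c, b, x, η, η', hd, h2, exists_beta_response_of_classical c b η η' (continuous_plane r q x) hgap hle hge⟩

/-- **Classical ⇒ kernel, density version.** [folklore] -/
theorem densPenetrationAtRate_of_classical {ρ : ℕ → ℝ} (h : ClassicalDensPenetrationAtRate G r ρ) :
    DensPenetrationAtRate G r ρ := by
  obtain ⟨θ, hθ, hfam⟩ := h
  refine ⟨θ, hθ, fun d₀ hd₀ => ?_⟩
  obtain ⟨c, b, x, η, η', t, t', hd, h2, hgap, hle, hge⟩ := hfam d₀ hd₀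
  exact ⟨c, b, x, η, η', hd, h2, exists_beta_response_of_classical c b η η' (continuous_dens r x) hgap hle hge⟩

/-! ### End-to-end conditional refutations from the classical statements -/

/-- A classical plane penetration at any rate with `ρ(n)·n⁴ → ∞` refutes `FBL6` for every unit map `a → 0`. [folklore] -/
theorem not_fbl6_of_classicalPlanePenetrationAtRate {ρ : ℕ → ℝ}
    (hρ : Tendsto (fun n : ℕ => ρ n * (n : ℝ) ^ 4) atTop atTop) (h : ClassicalPlanePenetrationAtRate G r ρ)
    (a : ℝ → ℝ) (hlim : Tendsto a atTop (𝓝 0)) : ¬ FBL6 G r a :=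
  not_fbl6_of_planePenetrationAtRate hρ (planePenetrationAtRate_of_classical h) a hlim

/-- The seat's target rate: a classical interior-flux PLATEAU (`ρ = 1/n²`) refutes `FBL6` for every unit map `a → 0`. [folklore] -/
theorem not_fbl6_of_classicalPlanePenetration_inv_sq (h : ClassicalPlanePenetrationAtRate G r fun n => 1 / (n : ℝ) ^ 2)
    (a : ℝ → ℝ) (hlim : Tendsto a atTop (𝓝 0)) : ¬ FBL6 G r a :=
  not_fbl6_of_classicalPlanePenetrationAtRate tendsto_inv_sq_mul_pow_four h a hlim

/-- A classical density penetration at any rate with `ρ(n)·n⁴ → ∞` refutes `FBL` for every unit map `a → 0`. [folklore] -/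
theorem not_fbl_of_classicalDensPenetrationAtRate {ρ : ℕ → ℝ}
    (hρ : Tendsto (fun n : ℕ => ρ n * (n : ℝ) ^ 4) atTop atTop) (h : ClassicalDensPenetrationAtRate G r ρ)
    (a : ℝ → ℝ) (hlim : Tendsto a atTop (𝓝 0)) : ¬ FBL G r a :=
  not_fbl_of_densPenetrationAtRate hρ (densPenetrationAtRate_of_classical h) a hlim

/-- … and the E1-osc clause (clause 1 of the registered 19353 stub `stub_refpkgT`) for every unit map `a → 0`, every `C₁`
and every `ℓ > 0`. [folklore] -/
theorem not_e1osc_of_classicalDensPenetrationAtRate {ρ : ℕ → ℝ}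
    (hρ : Tendsto (fun n : ℕ => ρ n * (n : ℝ) ^ 4) atTop atTop) (h : ClassicalDensPenetrationAtRate G r ρ)
    (a : ℝ → ℝ) (hlim : Tendsto a atTop (𝓝 0)) (C₁ ℓ : ℝ) (hℓ : 0 < ℓ) :
    ¬ ∃ β₁ : ℝ, ∀ β : ℝ, β₁ ≤ β → ∀ (c : Fin 4 → ℤ) (b : ℕ), (b : ℝ) * a β ≤ ℓ →
      ∀ (η η' : LGConfig 4 G) (x : Fin 4 → ℤ), 1 ≤ depth c b x →
        |kerE G r β c b η (dens G r x) - kerE G r β c b η' (dens G r x)| ≤ C₁ / (depth c b x : ℝ) ^ 4 :=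
  not_e1osc_of_densPenetrationAtRate hρ (densPenetrationAtRate_of_classical h) a hlim C₁ ℓ hℓ

end Laplace

end Summit.QuantumFields.YangMills.Cruxes.UVSeamRec.BoundaryLawPenetration

end
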